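import Literature.AlgebraicGeometry.Motives.HodgeStructure
import HarnessLib

/-!
# Conjugation-invariant vectors and sub-Hodge structures: `S_ℂ + F^p` meets the real points in `S_ℂ`

Family `hodge`, layer `Literature/AlgebraicGeometry/Motives`. Pure linear algebra of the tree's
`Motives.HodgeStructure` / `HodgeStructure.SubHodgeStructure` (Deligne, *Théorie de Hodge II*, 1.2.5,
2.1; Voisin, *Hodge Theory I*, §7.3.1), needed by the consumers of
`Literature/AlgebraicGeometry/HodgeTheory/SaitoGrFDeRhamCurveNet` (route
`HodgeConjecture/CurveNetMordellWeil`): if a conjugation-invariant vector `u ∈ V_ℂ` (e.g. a rational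
vector `u = 1 ⊗ v`) of a pure Hodge structure of weight `n` lies in `S_ℂ + F^p` for a sub-Hodge
structure `S` and some `p` with `2p > n`, then `u ∈ S_ℂ`. Conceptually: the quotient `V/S` with the
image filtration is again pure of weight `n` (strictness), and a real vector of a pure Hodge structure
of weight `n` lying in `F^p`, `2p > n`, vanishes (`F^p ∩ conj F^{n+1-p} = 0` and `F^p ⊆ F^{n+1-p}`).
The proof below is the direct elementwise version of this argument.

* `SubHodgeStructure.mem_baseChange_of_conj_eq` — the statement above (`p + q = n + 1`, `q ≤ p`).
* `SubHodgeStructure.ofRat_mem_baseChange_of_mem_sup` — the rational form in even weight `n = 2k`,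
  `p = k + 1`: a rational vector in `S_ℂ + F^{k+1}` lies in `S_ℂ` ("a Hodge class with vanishing
  `Gr_F^k`-component modulo `S` lies in `S`").

## References

* P. Deligne, *Théorie de Hodge II*, Publ. Math. IHÉS 40 (1971), 1.2.5, 1.2.10, 2.1.
* C. Voisin, *Hodge Theory and Complex Algebraic Geometry I* (2002), §7.3.1 (sub-Hodge structures,
  strictness of morphisms, Lemma 7.23–7.25).
-/

noncomputable section

open scoped TensorProduct

namespace Literature.AlgebraicGeometry.Motives

namespace HodgeStructure

variable {V : Type*} [AddCommGroup V] [Module ℚ V] {n : ℤ} {H : HodgeStructure V n}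

namespace SubHodgeStructure

/-- The complexification `S_ℂ ⊆ V_ℂ` of a sub-Hodge structure is the range of the complexified
inclusion (definitional unfolding of Mathlib's `Submodule.baseChange`). [folklore] -/
theorem baseChange_eq_range (S : H.SubHodgeStructure) :
    S.toSubmodule.baseChange ℂ = LinearMap.range (S.toSubmodule.subtype.baseChange ℂ) :=
  rfl

/-- `S_ℂ` is stable under complex conjugation. [cite: DeligneHodgeII1971, 2.1] -/
theorem conj_mem_baseChange (S : H.SubHodgeStructure) {x : ℂ ⊗[ℚ] V}
    (hx : x ∈ S.toSubmodule.baseChange ℂ) : conj x ∈ S.toSubmodule.baseChange ℂ := by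
  obtain ⟨y, rfl⟩ := hx
  exact ⟨conj y, (conj_baseChange _ y).symm⟩

/-- **Real vectors of `S_ℂ + F^p`, `2p > n`, lie in `S_ℂ`.** Let `S` be a sub-Hodge structure of a
pure Hodge structure `H` of weight `n`, `p + q = n + 1` with `q ≤ p`, and `u ∈ V_ℂ` with
`conj u = u`. If `u ∈ S_ℂ + F^p` then `u ∈ S_ℂ`. (Equivalently: the quotient Hodge structure `V/S`
is pure of weight `n`, and its real vectors in `F^p`, `2p > n`, vanish; Deligne, Hodge II, 1.2.5 and
1.2.10, Voisin I §7.3.1.) Proof: write `u = s + f`; then `f - conj f ∈ S_ℂ` splits along the Hodge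
decomposition `S_ℂ = (F^p ∩ S_ℂ) ⊕ (conj F^q ∩ S_ℂ)` of `S`, and `f - σ₁ = conj f + σ₂` lies in
`F^p ∩ conj F^q = 0`, so `f = σ₁ ∈ S_ℂ`. [cite: DeligneHodgeII1971, 1.2.5 and 1.2.10]
[cite: VoisinHodgeI2002, §7.3.1] -/
theorem mem_baseChange_of_conj_eq (S : H.SubHodgeStructure) {p q : ℤ} (hpq : p + q = n + 1)
    (hqp : q ≤ p) {u : ℂ ⊗[ℚ] V} (hu : conj u = u)
    (hmem : u ∈ S.toSubmodule.baseChange ℂ ⊔ H.F p) : u ∈ S.toSubmodule.baseChange ℂ := by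
  obtain ⟨s, hs, f, hf, rfl⟩ := Submodule.mem_sup.mp hmem
  -- `f - conj f = conj s - s ∈ S_ℂ`
  have hdiff : f - conj f ∈ S.toSubmodule.baseChange ℂ := by
    have hconj : conj s + conj f = s + f := by rw [← map_add]; exact hu
    have : f - conj f = conj s - s := by
      rw [sub_eq_sub_iff_add_eq_add, add_comm, ← hconj, add_comm]
    rw [this]
    exact Submodule.sub_mem _ (S.conj_mem_baseChange hs) hs
  -- split it along the Hodge decomposition of `S`
  obtain ⟨y, hy⟩ := hdiff
  set ι := S.toSubmodule.subtype.baseChange ℂ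
  have htop : y ∈ (H.F p).comap ι ⊔ (complexConj (H.F q)).comap ι := by
    rw [(S.isCompl p q hpq).sup_eq_top]
    exact Submodule.mem_top
  obtain ⟨y₁, hy₁, y₂, hy₂, rfl⟩ := Submodule.mem_sup.mp htop
  rw [Submodule.mem_comap] at hy₁ hy₂
  -- `f - ι y₁ = conj f + ι y₂ ∈ F^p ∩ conj F^q = 0`
  have hFp : f - ι y₁ ∈ H.F p := Submodule.sub_mem _ hf hy₁
  have hconjf : conj f ∈ complexConj (H.F q) := by
    rw [mem_complexConj, conj_conj]
    exact H.antitone_F hqp hf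
  have hCq : f - ι y₁ ∈ complexConj (H.F q) := by
    have heq : f - ι y₁ = conj f + ι y₂ := by
      rw [map_add, eq_sub_iff_add_eq] at hy
      calc f - ι y₁ = (ι y₁ + ι y₂ + conj f) - ι y₁ := by rw [hy]
        _ = conj f + ι y₂ := by abel
    rw [heq]
    exact Submodule.add_mem _ hconjf hy₂
  have hzero : f - ι y₁ = 0 := by
    have hbot := (H.isCompl_F_complexConj p q hpq).disjoint.le_bot (Submodule.mem_inf.mpr ⟨hFp, hCq⟩)
    rwa [Submodule.mem_bot] at hbot
  have hfS : f ∈ S.toSubmodule.baseChange ℂ := ⟨y₁, (sub_eq_zero.mp hzero).symm⟩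
  exact Submodule.add_mem _ hs hfS

/-- **Rational form, even weight**: in a pure Hodge structure of weight `n = 2k`, a rational vector
lying in `S_ℂ + F^{k+1}` for a sub-Hodge structure `S` lies in `S_ℂ`. In words: a Hodge class whose
`Gr_F^k`-component vanishes modulo `S` lies in `S` modulo nothing — the linear-algebra step by which
the route `CurveNetMordellWeil` turns Hodge support of the `Gr_F^q`-component into support of the
class. [cite: DeligneHodgeII1971, 1.2.5 and 1.2.10] [cite: VoisinHodgeI2002, §7.3.1] -/
theorem ofRat_mem_baseChange_of_mem_sup (S : H.SubHodgeStructure) {k : ℤ} (hn : n = 2 * k) (v : V)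
    (hmem : ofRat v ∈ S.toSubmodule.baseChange ℂ ⊔ H.F (k + 1)) :
    ofRat v ∈ S.toSubmodule.baseChange ℂ :=
  S.mem_baseChange_of_conj_eq (p := k + 1) (q := k) (by rw [hn]; ring) (by omega) (conj_ofRat v) hmem

/-- The same with an explicit coset representative: if `ofRat v - y ∈ S_ℂ` for some `y ∈ F^{k+1}`
(weight `2k`), then `ofRat v ∈ S_ℂ` (and hence `y ∈ S_ℂ`). [cite: DeligneHodgeII1971, 1.2.5 and 1.2.10] -/
theorem ofRat_mem_baseChange_of_sub_mem (S : H.SubHodgeStructure) {k : ℤ} (hn : n = 2 * k) (v : V)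
    {y : ℂ ⊗[ℚ] V} (hy : y ∈ H.F (k + 1)) (hsub : ofRat v - y ∈ S.toSubmodule.baseChange ℂ) :
    ofRat v ∈ S.toSubmodule.baseChange ℂ :=
  S.ofRat_mem_baseChange_of_mem_sup hn v
    (Submodule.mem_sup.mpr ⟨ofRat v - y, hsub, y, hy, sub_add_cancel _ _⟩)

end SubHodgeStructure

end HodgeStructure

end Literature.AlgebraicGeometry.Motives

end
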